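import Summits.QuantumFields.YangMills.Theorems.BalabanLadderROTKingLimitCrystallographicFrame
import HarnessLib

/-!
# Crux `ROT` (stmt-QuantumFields-20042), stub `stub_kingLimit` — crystallographic exclusion of `C_{4m}` (2/3): TWO CIRCLES GENERATE THE
# COORDINATE CIRCLE, and King's density step transported by a frame

Helper file (`--supports stmt-QuantumFields-20042 --as helper`; seat `ymfull-r2d-prover-1`, R590-ym item (15)); part 2 of 3 (part 1:
✓`…CrystallographicFrame.lean` — the composite `R₀₁(π/(2m)) ≫ σ` is a rotation `Q R₀₁(ω) Q⁻¹` of irrational angle about a unit axis `n = Q e₂`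
with `n₃ = 0`, `n₀ = n₂ ≥ 0`, `n₂² ≥ 1/3`; part 3: `…Crystallographic.lean` — the exclusion and the refined residual of the registered stub).

THIS FILE (elementary geometry of `ℝ⁴` + the intermediate value theorem; no Yang–Mills object):
* §5 ★ `planeRot_mem_of_conjCircle` — TWO CIRCLES GENERATE THE COORDINATE CIRCLE: if a class `P` of isometries closed under composition and
  inverses contains the whole circle `Q R₀₁(b) Q⁻¹` about `n = Q e₂` (`Q` of determinant `1` fixing `e₃`; `n₃ = 0`, `n₀ = n₂ ≥ 0`, `n₂² ≥ 1/3`)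
  and the flip `σ₀` of `e₀`, then `R₀₁(θ) ∈ P` for every `θ`.  The conjugate circle about `σ₀ n` moves `n` continuously
  (`continuous_planeRot_angle`) from inner product `1` with `n` (`b = 0`) to `2p² − 1 < 0 ≤ n₂ = ⟪e₂, n⟫` (`b = π`; `p = ⟪σ₀n, n⟫ = 1 − 2n₂² ∈
  [0, 1/3]`), so by the INTERMEDIATE VALUE THEOREM some `C ∈ P` has `⟪C n, n⟫ = ⟪e₂, n⟫`; transitivity on circles (✓`exists_planeRot_apply_eq`,
  transported by `Q`) gives a rotation `D ∈ P` about `n` with `D (C n) = e₂`; `k = C ≫ D ∈ P` maps `n ↦ e₂`, fixes `e₃`, `det k = 1`, so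
  `Q ≫ k = planeRot 0 χ` (✓`Mopup.exists_eq_planeRot`) and `R₀₁(θ) = k (Q R₀₁(θ) Q⁻¹) k⁻¹ ∈ P` (✓`planeRot_add_apply`).

0 sorry, standard axioms, no definition.  HONEST LABEL: structural; `KingLimit`, `ROT` and the Yang–Mills mass gap are NOT proved.

References: C. King, Commun. Math. Phys. 103 (1986) 323–349, Thm 2.4 and (4.10) (density mechanism); K. Osterwalder, R. Schrader, CMP 31
(1973) §2; H. S. M. Coxeter, Regular Polytopes (1973) §3.7.
-/

set_option autoImplicit false

noncomputable section

open scoped SchwartzMap InnerProductSpace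
open MeasureTheory Filter Topology
open Literature.MathematicalPhysics.QuantumFieldTheory Literature.MathematicalPhysics.QuantumLattice
open Literature.MathematicalPhysics.AQFT Literature.Probability.LatticeModels
open Summit.QuantumFields.YangMills.Cruxes.OSLegsFromFemtoAndGap.DlrCollarTransfer
open Summit.QuantumFields.YangMills.Cruxes.OSLegsAtWeakCouplingC.Sketch
open Summit.QuantumFields.YangMills.Cruxes.OSLegsAtWeakCouplingC.Y2Bridge
open Summit.QuantumFields.YangMills.Theorems.NPointIsotropy.Negative (E4)
open Summit.QuantumFields.YangMills.Theorems.NPointIsotropy.ComplexRotationBandlimit.Mopup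
  (exists_eq_planeRot exists_cos_eq_and_sin_eq)
open Summit.QuantumFields.YangMills.Theorems.CurvatureBoostCovariance.BoostsInheritMirrors.OrbitBandlimit
  (planeRot_add_apply planeRot_symm_apply' det_planeRot)
open Literature.Analysis.FluidPDE (signedPermIsometry signedPermIsometry_apply isSignedPermIsometry_signedPermIsometry)

namespace Summit.QuantumFields.YangMills.Theorems.ROT.KingStabiliser

/-! ## §5 Geometry: a full circle of symmetries about the axis `n = Q e₂` plus the flip of `e₀` give every `R₀₁(θ)` -/

/-- Continuity of the plane rotation in the angle, at a fixed vector. [folklore] -/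
theorem continuous_planeRot_angle (x : E4) : Continuous fun b : ℝ => planeRot (0 : Fin 3) b x := by
  have h := ((continuous_apply (0 : Fin 1)).comp (continuous_planeRot_diag (n := 1) (0 : Fin 3))).comp
    (continuous_id.prodMk (continuous_const (y := fun _ : Fin 1 => x)))
  exact h

set_option maxHeartbeats 400000 in
/-- ★ **Two circles generate the coordinate circle.**  Let `P` be a class of linear isometries of `ℝ⁴` closed under composition
and inverses (a stabiliser).  Let `Q` be an isometry of determinant `1` fixing `e₃` whose image `n = Q e₂` of `e₂` satisfies
`n₃ = 0`, `n₀ = n₂ ≥ 0`, `n₂² ≥ 1/3`.  If `P` contains the whole circle `Q ∘ R₀₁(b) ∘ Q⁻¹`, `b ∈ ℝ` (all rotations about `n`) and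
the flip `σ₀` of `e₀`, then `P` contains `R₀₁(θ)` for every `θ`.  Mechanism: the rotations about `σ₀ n` (conjugates by `σ₀`) move
`n` continuously from `n` (`b = 0`) to a vector making inner product `2⟪σ₀n,n⟫² − 1 < 0 ≤ n₂` with `n` (`b = π`), so by the
intermediate value theorem one of them, `C`, has `⟪C n, n⟫ = ⟪e₂, n⟫`; a rotation `D` about `n` then carries `C n` to `e₂`
(transitivity on circles); `k = D ∘ C ∈ P` maps `n ↦ e₂` and fixes `e₃` with determinant `1`, so `k ∘ Q = R₀₁(χ)` for some `χ`
(✓`exists_eq_planeRot`) and `R₀₁(θ) = k (Q R₀₁(θ) Q⁻¹) k⁻¹ ∈ P`. [folklore] -/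
theorem planeRot_mem_of_conjCircle (P : (E4 ≃ₗᵢ[ℝ] E4) → Prop)
    (htrans : ∀ A B : E4 ≃ₗᵢ[ℝ] E4, P A → P B → P (A.trans B))
    (hsymm : ∀ A : E4 ≃ₗᵢ[ℝ] E4, P A → P A.symm)
    (Q : E4 ≃ₗᵢ[ℝ] E4) (hQ3 : Q (EuclideanSpace.single 3 1) = EuclideanSpace.single 3 1)
    (hQdet : LinearMap.det (Q.toLinearEquiv : E4 →ₗ[ℝ] E4) = 1)
    (hn3 : Q (EuclideanSpace.single 2 1) 3 = 0) (hn02 : Q (EuclideanSpace.single 2 1) 0 = Q (EuclideanSpace.single 2 1) 2)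
    (hn2 : 0 ≤ Q (EuclideanSpace.single 2 1) 2) (hn2sq : 1 / 3 ≤ (Q (EuclideanSpace.single 2 1) 2) ^ 2)
    (hcirc : ∀ b : ℝ, P (Q.symm.trans ((planeRot (0 : Fin 3) b).trans Q)))
    (hτ : P (signedPermIsometry (1 : Equiv.Perm (Fin 4)) (![-1, 1, 1, 1] : Fin 4 → ℤˣ)))
    (θ : ℝ) : P (planeRot (0 : Fin 3) θ) := by
  have inner_apply_eq_inner_symm : ∀ (R : E4 ≃ₗᵢ[ℝ] E4) (x y : E4), ⟪R x, y⟫_ℝ = ⟪x, R.symm y⟫_ℝ :=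
    fun R x y => by rw [← R.inner_map_map x (R.symm y), LinearIsometryEquiv.apply_symm_apply]
  have nsq : ∀ x : E4, ‖x‖ ^ 2 = x 0 ^ 2 + x 1 ^ 2 + x 2 ^ 2 + x 3 ^ 2 := fun x => by
    rw [norm_sq_eq_inner_sum4, inner_eq_sum4]; ring
  -- abbreviations (opaque names with defining equations)
  obtain ⟨n, hn⟩ : ∃ n : E4, n = Q (EuclideanSpace.single 2 1) := ⟨_, rfl⟩
  obtain ⟨τ, hτdef⟩ : ∃ τ : E4 ≃ₗᵢ[ℝ] E4, τ = signedPermIsometry (1 : Equiv.Perm (Fin 4)) (![-1, 1, 1, 1] : Fin 4 → ℤˣ) :=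
    ⟨_, rfl⟩
  rw [← hn] at hn3 hn02 hn2 hn2sq
  rw [← hτdef] at hτ
  have hn_norm : ‖n‖ = 1 := by rw [hn, LinearIsometryEquiv.norm_map, PiLp.norm_single, norm_one]
  have hnsq : n 0 ^ 2 + n 1 ^ 2 + n 2 ^ 2 = 1 := by
    have h := nsq n
    rw [hn_norm, hn3] at h
    nlinarith [h]
  have hQ3' : Q.symm (EuclideanSpace.single 3 1) = EuclideanSpace.single 3 1 := by
    rw [show Q.symm (EuclideanSpace.single 3 1) = Q.symm (Q (EuclideanSpace.single 3 1)) by rw [hQ3]]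
    exact Q.symm_apply_apply _
  -- coordinates of `τ⁻¹`, and `τ e₃ = e₃`
  have hτ_symm_apply : ∀ x : E4, τ.symm x 0 = -x 0 ∧ τ.symm x 1 = x 1 ∧ τ.symm x 2 = x 2 ∧ τ.symm x 3 = x 3 := fun x => by
    refine ⟨?_, ?_, ?_, ?_⟩ <;>
      simp [hτdef, Literature.Analysis.FluidPDE.signedPermIsometry_symm_apply, Equiv.Perm.one_def]
  have hτ3 : τ (EuclideanSpace.single 3 1) = EuclideanSpace.single 3 1 := by
    ext j; fin_cases j <;> simp [hτdef, signedPermIsometry_apply]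
  have hτ3' : τ.symm (EuclideanSpace.single 3 1) = EuclideanSpace.single 3 1 := by
    rw [show τ.symm (EuclideanSpace.single 3 1) = τ.symm (τ (EuclideanSpace.single 3 1)) by rw [hτ3]]
    exact τ.symm_apply_apply _
  have hR3 : ∀ b : ℝ, planeRot (0 : Fin 3) b (EuclideanSpace.single 3 (1 : ℝ)) = EuclideanSpace.single 3 1 := fun b => by
    ext j; fin_cases j <;> simp [planeRot_apply]
  -- the conjugated circle about `τ n`: `C b = τ ∘ (Q R_b Q⁻¹) ∘ τ⁻¹`
  obtain ⟨C, hC⟩ : ∃ C : ℝ → (E4 ≃ₗᵢ[ℝ] E4),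
      C = fun b => τ.symm.trans ((Q.symm.trans ((planeRot (0 : Fin 3) b).trans Q)).trans τ) := ⟨_, rfl⟩
  have hCP : ∀ b, P (C b) := fun b => by
    rw [hC]; exact htrans _ _ (hsymm _ hτ) (htrans _ _ (hcirc b) hτ)
  have hC_apply : ∀ b x, C b x = τ (Q (planeRot (0 : Fin 3) b (Q.symm (τ.symm x)))) := fun b x => by
    rw [hC]; rfl
  have hC3 : ∀ b, C b (EuclideanSpace.single 3 1) = EuclideanSpace.single 3 1 := fun b => by
    rw [hC_apply, hτ3', hQ3', hR3, hQ3, hτ3]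
  have hCdet : ∀ b, LinearMap.det ((C b).toLinearEquiv : E4 →ₗ[ℝ] E4) = 1 := fun b => by
    rw [hC, det_conj, det_conj,
      det_planeRot]
  -- the inner product `f b = ⟪C_b n, n⟫ = ⟪R_b y, y⟫`, `y = Q⁻¹ τ⁻¹ n`: continuous, `f 0 = 1`, `f π = 2p² − 1`
  obtain ⟨y, hy⟩ : ∃ y : E4, y = Q.symm (τ.symm n) := ⟨_, rfl⟩
  have hf_eq : ∀ b, ⟪C b n, n⟫_ℝ = ⟪planeRot (0 : Fin 3) b y, y⟫_ℝ := fun b => by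
    rw [hC_apply, inner_apply_eq_inner_symm τ, inner_apply_eq_inner_symm Q, hy]
  have hy_norm : y 0 ^ 2 + y 1 ^ 2 + y 2 ^ 2 + y 3 ^ 2 = 1 := by
    rw [← nsq, hy, LinearIsometryEquiv.norm_map, LinearIsometryEquiv.norm_map, hn_norm, one_pow]
  have hy3 : y 3 = 0 := by
    have h : ⟪y, EuclideanSpace.single 3 (1 : ℝ)⟫_ℝ = y 3 := by simp [EuclideanSpace.inner_single_right]
    rw [← h, hy, inner_apply_eq_inner_symm Q.symm, LinearIsometryEquiv.symm_symm, hQ3,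
      inner_apply_eq_inner_symm τ.symm, LinearIsometryEquiv.symm_symm, hτ3]
    simp [EuclideanSpace.inner_single_right, hn3]
  -- `p = y₂ = ⟪τ⁻¹ n, n⟫ = −n₀² + n₁² + n₂² ∈ [0, 1/3]`
  have hy2 : y 2 = -(n 0) ^ 2 + (n 1) ^ 2 + (n 2) ^ 2 := by
    have h : ⟪y, EuclideanSpace.single 2 (1 : ℝ)⟫_ℝ = y 2 := by simp [EuclideanSpace.inner_single_right]
    rw [← h, hy, inner_apply_eq_inner_symm Q.symm, LinearIsometryEquiv.symm_symm, ← hn, inner_eq_sum4,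
      (hτ_symm_apply n).1, (hτ_symm_apply n).2.1, (hτ_symm_apply n).2.2.1, (hτ_symm_apply n).2.2.2, hn3]
    ring
  have hp0 : 0 ≤ y 2 := by rw [hy2, hn02]; nlinarith [hnsq, hn02]
  have hp1 : y 2 ≤ 1 / 3 := by rw [hy2, hn02]; nlinarith [hnsq, hn2sq, hn02]
  have hf0 : ⟪C 0 n, n⟫_ℝ = 1 := by
    rw [hf_eq, planeRot_zero_apply, inner_eq_sum4]
    linear_combination hy_norm
  have hfπ : ⟪C Real.pi n, n⟫_ℝ = 2 * (y 2) ^ 2 - 1 := by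
    rw [hf_eq, inner_planeRot_self, Real.cos_pi, hy3]
    nlinarith [hy_norm, hy3]
  have hfπ_le : ⟪C Real.pi n, n⟫_ℝ ≤ n 2 := by
    have h9 : y 2 * y 2 ≤ 1 / 3 * (1 / 3) := mul_le_mul hp1 hp1 hp0 (by norm_num)
    rw [hfπ, sq]
    linarith [h9, hn2]
  have hq_le : n 2 ≤ ⟪C 0 n, n⟫_ℝ := by
    have h1 : n 2 ^ 2 ≤ 1 := by nlinarith [hnsq, sq_nonneg (n 0), sq_nonneg (n 1)]
    rw [hf0]
    exact (sq_le_one_iff₀ hn2).1 h1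
  -- intermediate value theorem on `[0, π]`
  have hcont : Continuous fun b : ℝ => ⟪C b n, n⟫_ℝ := by
    have h : (fun b : ℝ => ⟪C b n, n⟫_ℝ) = fun b => ⟪τ (Q (planeRot (0 : Fin 3) b y)), n⟫_ℝ := by
      funext b; rw [hC_apply, hy]
    rw [h]
    exact (τ.continuous.comp (Q.continuous.comp (continuous_planeRot_angle y))).inner continuous_const
  obtain ⟨b₀, -, hb₀⟩ : ∃ b₀ ∈ Set.Icc (0 : ℝ) Real.pi, ⟪C b₀ n, n⟫_ℝ = n 2 :=
    intermediate_value_Icc' Real.pi_pos.le hcont.continuousOn ⟨hfπ_le, hq_le⟩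
  -- the vector `v = C_{b₀} n` and its transports `u = Q⁻¹ v`, `w = Q⁻¹ e₂`
  obtain ⟨v, hv⟩ : ∃ v : E4, v = C b₀ n := ⟨_, rfl⟩
  have hv_norm : ‖v‖ = 1 := by rw [hv, LinearIsometryEquiv.norm_map, hn_norm]
  have hv3 : v 3 = 0 := by
    have h : ⟪v, EuclideanSpace.single 3 (1 : ℝ)⟫_ℝ = v 3 := by simp [EuclideanSpace.inner_single_right]
    rw [← h, hv, ← hC3 b₀, LinearIsometryEquiv.inner_map_map]
    simp [EuclideanSpace.inner_single_right, hn3]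
  obtain ⟨u, hu⟩ : ∃ u : E4, u = Q.symm v := ⟨_, rfl⟩
  obtain ⟨w, hw⟩ : ∃ w : E4, w = Q.symm (EuclideanSpace.single 2 1) := ⟨_, rfl⟩
  have hu2 : u 2 = n 2 := by
    have h : ⟪u, EuclideanSpace.single 2 (1 : ℝ)⟫_ℝ = u 2 := by simp [EuclideanSpace.inner_single_right]
    rw [← h, hu, inner_apply_eq_inner_symm Q.symm, LinearIsometryEquiv.symm_symm, ← hn, hv]
    exact hb₀
  have hw2 : w 2 = n 2 := by
    have h : ⟪w, EuclideanSpace.single 2 (1 : ℝ)⟫_ℝ = w 2 := by simp [EuclideanSpace.inner_single_right]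
    rw [← h, hw, inner_apply_eq_inner_symm Q.symm, LinearIsometryEquiv.symm_symm, ← hn]
    simp [EuclideanSpace.inner_single_left]
  have hu3 : u 3 = 0 := by
    have h : ⟪u, EuclideanSpace.single 3 (1 : ℝ)⟫_ℝ = u 3 := by simp [EuclideanSpace.inner_single_right]
    rw [← h, hu, inner_apply_eq_inner_symm Q.symm, LinearIsometryEquiv.symm_symm, hQ3]
    simp [EuclideanSpace.inner_single_right, hv3]
  have hw3 : w 3 = 0 := by
    have h : ⟪w, EuclideanSpace.single 3 (1 : ℝ)⟫_ℝ = w 3 := by simp [EuclideanSpace.inner_single_right]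
    rw [← h, hw, inner_apply_eq_inner_symm Q.symm, LinearIsometryEquiv.symm_symm, hQ3]
    simp [EuclideanSpace.inner_single_right]
  have hu_norm : u 0 ^ 2 + u 1 ^ 2 + u 2 ^ 2 + u 3 ^ 2 = 1 := by
    rw [← nsq, hu, LinearIsometryEquiv.norm_map, hv_norm, one_pow]
  have hw_norm : w 0 ^ 2 + w 1 ^ 2 + w 2 ^ 2 + w 3 ^ 2 = 1 := by
    rw [← nsq, hw, LinearIsometryEquiv.norm_map, PiLp.norm_single, norm_one, one_pow]
  have hρ : u 0 ^ 2 + u 1 ^ 2 = w 0 ^ 2 + w 1 ^ 2 := by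
    rw [hu2, hu3] at hu_norm
    rw [hw2, hw3] at hw_norm
    linarith
  obtain ⟨a, ha⟩ : ∃ a : ℝ, planeRot (0 : Fin 3) a u = w :=
    exists_planeRot_apply_eq (hu2.trans hw2.symm) (hu3.trans hw3.symm) hρ
  -- `D` = the rotation about `n` carrying `v` to `e₂`; `k = C ≫ D ∈ P` maps `n ↦ e₂`, fixes `e₃`, `det k = 1`
  obtain ⟨D, hD⟩ : ∃ D : E4 ≃ₗᵢ[ℝ] E4, D = Q.symm.trans ((planeRot (0 : Fin 3) a).trans Q) := ⟨_, rfl⟩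
  have hD_apply : ∀ x, D x = Q (planeRot (0 : Fin 3) a (Q.symm x)) := fun x => by rw [hD]; rfl
  have hDv : D v = EuclideanSpace.single 2 1 := by
    rw [hD_apply, ← hu, ha, hw, Q.apply_symm_apply]
  have hD3 : D (EuclideanSpace.single 3 1) = EuclideanSpace.single 3 1 := by
    rw [hD_apply, hQ3', hR3, hQ3]
  obtain ⟨k, hk⟩ : ∃ k : E4 ≃ₗᵢ[ℝ] E4, k = (C b₀).trans D := ⟨_, rfl⟩
  have hk_apply : ∀ x, k x = D (C b₀ x) := fun x => by rw [hk]; rfl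
  have hkP : P k := by rw [hk]; exact htrans _ _ (hCP b₀) (by rw [hD]; exact hcirc a)
  have hkn : k n = EuclideanSpace.single 2 1 := by rw [hk_apply, ← hv, hDv]
  have hk3 : k (EuclideanSpace.single 3 1) = EuclideanSpace.single 3 1 := by rw [hk_apply, hC3, hD3]
  have hkdet : LinearMap.det (k.toLinearEquiv : E4 →ₗ[ℝ] E4) = 1 := by
    rw [hk, det_trans, hD, det_conj, hCdet,
      det_planeRot, mul_one]
  -- `M' = Q ≫ k` fixes `e₂, e₃` with determinant one: a plane rotation `R₀₁(χ)`
  obtain ⟨M', hM'⟩ : ∃ M' : E4 ≃ₗᵢ[ℝ] E4, M' = Q.trans k := ⟨_, rfl⟩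
  have hM'_apply : ∀ x, M' x = k (Q x) := fun x => by rw [hM']; rfl
  have hM'_symm_apply : ∀ x, M'.symm x = Q.symm (k.symm x) := fun x => by rw [hM']; rfl
  have hM'2 : M' (EuclideanSpace.single 2 1) = EuclideanSpace.single 2 1 := by rw [hM'_apply, ← hn, hkn]
  have hM'3 : M' (EuclideanSpace.single 3 1) = EuclideanSpace.single 3 1 := by rw [hM'_apply, hQ3, hk3]
  have hM'det : LinearMap.det (M'.toLinearEquiv : E4 →ₗ[ℝ] E4) = 1 := by
    rw [hM', det_trans, hkdet, hQdet, mul_one]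
  obtain ⟨χ, hχ⟩ := exists_eq_planeRot M' hM'det hM'2 hM'3
  -- `R₀₁(θ) = k (Q R₀₁(θ) Q⁻¹) k⁻¹ ∈ P`
  have hmem : P (k.symm.trans ((Q.symm.trans ((planeRot (0 : Fin 3) θ).trans Q)).trans k)) :=
    htrans _ _ (hsymm _ hkP) (htrans _ _ (hcirc θ) hkP)
  have hEq : k.symm.trans ((Q.symm.trans ((planeRot (0 : Fin 3) θ).trans Q)).trans k) = planeRot (0 : Fin 3) θ := by
    refine LinearIsometryEquiv.ext fun x => ?_
    have h1 : (k.symm.trans ((Q.symm.trans ((planeRot (0 : Fin 3) θ).trans Q)).trans k)) x =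
        M' (planeRot (0 : Fin 3) θ (M'.symm x)) := by
      rw [hM'_apply, hM'_symm_apply]; rfl
    rw [h1, hχ,
      planeRot_symm_apply',
      ← planeRot_add_apply, ← planeRot_add_apply]
    ring_nf
  rw [hEq] at hmem
  exact hmem

end Summit.QuantumFields.YangMills.Theorems.ROT.KingStabiliser

end
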